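import Mathlib
import Summits.QuantumFields.QCD.Theorems.QuarksAsStableActionUnquenchedChessboardBoundStubSitePeelPSD
import Summits.QuantumFields.QCD.Theorems.QuarksAsStableActionUnquenchedChessboardBoundStubMarginalRP
import HarnessLib

/-!
# Polarised Gram data and the quadratic reflection-positivity inequality (stubs `stub_torusPeel` /
`stub_sitePeel` of crux stmt-QuantumFields-9735, line Sketch — wave-2 helper 3a)

* `PolarData`: a shared positive-semidefinite kernel (function of the in-plane links) with TWO bounded
  measurable feature families of the closed positive-time half; `form s s'` pairs family `s` at `U`
  with family `s'` at `Θ'U`. Polar data multiply (`PolarData.mul`, `form_mul`, `polarProd`), come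
  from Gram data (`PolarData.ofGram`), and the linear combination `a + t b` of the two families is a
  Gram datum (`PolarData.lin`) — whence, by `GramData.integral_nonneg`,
  `0 ≤ ∫ form₁₁ + conj t ∫ form₁₂ + t ∫ form₂₁ + |t|² ∫ form₂₂` for every `t ∈ ℂ`
  (`PolarData.integral_lin_nonneg`), and the Cauchy–Schwarz consequence
  (`cs_of_forall_quadratic`).
(The polar datum of the diluted determinant and the peeling inequality are in helper 3b.)
-/

noncomputable section

open Matrix Complex Finset MeasureTheory
open Literature.MathematicalPhysics.QuantumLattice Literature.MathematicalPhysics.QuantumFieldTheory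
open Literature.Probability.LatticeModels
open Summit.QuantumFields.QCD.Theorems.QuarksAsStableAction
open scoped ComplexConjugate BigOperators Kronecker ComplexOrder

namespace Summit.QuantumFields.QCD.Theorems.UnquenchedChessboardBoundLine

/-! ## Polar data -/

section Polar

variable {L : ℕ} [NeZero L] [Fact (1 < L)] {G : Type*} [Group G] [MeasurableSpace G]

variable (L G) in
/-- A **polar datum**: a finite positive-semidefinite kernel depending on the shared links and two
families (indexed by `Bool`) of bounded measurable features depending on the links of the closed
positive-time half. -/
structure PolarData where
  /-- the index type -/
  κ : Type
  /-- it is finite -/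
  [hκ : Fintype κ]
  /-- the kernel -/
  K : GaugeConfig 4 L G → Matrix κ κ ℂ
  /-- the two feature families -/
  feat : Bool → κ → GaugeConfig 4 L G → ℂ
  /-- positivity -/
  psd : ∀ U, (K U).PosSemidef
  /-- measurability of the kernel -/
  measK : ∀ i j, Measurable fun U => K U i j
  /-- boundedness of the kernel -/
  bddK : ∃ C : ℝ, ∀ U i j, ‖K U i j‖ ≤ C
  /-- locality of the kernel -/
  depK : ∀ i j, DependsOn (fun U => K U i j) ((WilsonSiteRP.sharedEdges : Finset (Edge 4 L)) : Set (Edge 4 L))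
  /-- measurability of the features -/
  measF : ∀ s i, Measurable (feat s i)
  /-- boundedness of the features -/
  bddF : ∃ C : ℝ, ∀ s i U, ‖feat s i U‖ ≤ C
  /-- locality of the features -/
  depF : ∀ s i, DependsOn (feat s i)
    ((WilsonSiteRP.sitePosEdges ∪ WilsonSiteRP.sharedEdges : Finset (Edge 4 L)) : Set (Edge 4 L))

attribute [instance] PolarData.hκ

/-- The sesquilinear pairing of family `s` at `U` with family `s'` at `Θ'U` through the kernel. -/
def PolarData.form (d : PolarData L G) (s s' : Bool) (U : GaugeConfig 4 L G) : ℂ :=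
  ∑ i, ∑ j, d.K U i j * d.feat s i U * conj (d.feat s' j (GaugeConfig.negReflect U))

/-- **Products of polar data.** -/
def PolarData.mul (d₁ d₂ : PolarData L G) : PolarData L G where
  κ := d₁.κ × d₂.κ
  K U := d₁.K U ⊗ₖ d₂.K U
  feat s i U := d₁.feat s i.1 U * d₂.feat s i.2 U
  psd U := (d₁.psd U).kronecker (d₂.psd U)
  measK i j := (d₁.measK i.1 j.1).mul (d₂.measK i.2 j.2)
  bddK := by
    obtain ⟨C₁, h₁⟩ := d₁.bddK
    obtain ⟨C₂, h₂⟩ := d₂.bddK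
    refine ⟨C₁ * C₂, fun U i j => ?_⟩
    rw [Matrix.kroneckerMap_apply, norm_mul]
    exact mul_le_mul (h₁ U i.1 j.1) (h₂ U i.2 j.2) (norm_nonneg _) ((norm_nonneg _).trans (h₁ U i.1 j.1))
  depK i j U V hUV := by
    have h1 := d₁.depK i.1 j.1 hUV
    have h2 := d₂.depK i.2 j.2 hUV
    simp only at h1 h2
    simp only [Matrix.kroneckerMap_apply, h1, h2]
  measF s i := (d₁.measF s i.1).mul (d₂.measF s i.2)
  bddF := by
    obtain ⟨C₁, h₁⟩ := d₁.bddF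
    obtain ⟨C₂, h₂⟩ := d₂.bddF
    refine ⟨C₁ * C₂, fun s i U => ?_⟩
    rw [norm_mul]
    exact mul_le_mul (h₁ s i.1 U) (h₂ s i.2 U) (norm_nonneg _) ((norm_nonneg _).trans (h₁ s i.1 U))
  depF s i U V hUV := by simp only [d₁.depF s i.1 hUV, d₂.depF s i.2 hUV]

omit [Fact (1 < L)] in
/-- The pairing is multiplicative. -/
theorem PolarData.form_mul (d₁ d₂ : PolarData L G) (s s' : Bool) (U : GaugeConfig 4 L G) :
    (d₁.mul d₂).form s s' U = d₁.form s s' U * d₂.form s s' U := by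
  show ∑ i : d₁.κ × d₂.κ, ∑ j : d₁.κ × d₂.κ, (d₁.K U ⊗ₖ d₂.K U) i j * (d₁.feat s i.1 U * d₂.feat s i.2 U) *
      conj (d₁.feat s' j.1 (GaugeConfig.negReflect U) * d₂.feat s' j.2 (GaugeConfig.negReflect U)) =
    (∑ i, ∑ j, d₁.K U i j * d₁.feat s i U * conj (d₁.feat s' j (GaugeConfig.negReflect U))) *
      ∑ i, ∑ j, d₂.K U i j * d₂.feat s i U * conj (d₂.feat s' j (GaugeConfig.negReflect U))
  rw [Finset.sum_mul_sum]
  simp_rw [Finset.sum_mul_sum, Fintype.sum_prod_type]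
  refine Finset.sum_congr rfl fun i _ => Finset.sum_congr rfl fun x _ => Finset.sum_congr rfl fun y _ =>
    Finset.sum_congr rfl fun j _ => ?_
  simp only [Matrix.kroneckerMap_apply, map_mul]
  ring

/-- The unit polar datum. -/
def PolarData.one : PolarData L G where
  κ := Unit
  K _ := 1
  feat _ _ _ := 1
  psd _ := Matrix.PosSemidef.one
  measK _ _ := measurable_const
  bddK := ⟨1, fun U i j => by simp⟩
  depK _ _ _ _ _ := rfl
  measF _ _ := measurable_const
  bddF := ⟨1, fun _ _ _ => by simp⟩
  depF _ _ _ _ _ := rfl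

omit [Fact (1 < L)] in
/-- The unit pairs to `1`. -/
theorem PolarData.form_one (s s' : Bool) (U : GaugeConfig 4 L G) : (PolarData.one : PolarData L G).form s s' U = 1 := by
  simp [PolarData.form, PolarData.one]

/-- Finite products of polar data. -/
def polarProd : {n : ℕ} → (Fin n → PolarData L G) → PolarData L G
  | 0, _ => PolarData.one
  | _ + 1, d => (d 0).mul (polarProd fun f => d f.succ)

omit [Fact (1 < L)] in
/-- The pairing of a product is the product of the pairings. -/
theorem form_polarProd : ∀ {n : ℕ} (d : Fin n → PolarData L G) (s s' : Bool) (U : GaugeConfig 4 L G),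
    (polarProd d).form s s' U = ∏ f, (d f).form s s' U
  | 0, d, s, s', U => by simp [polarProd, PolarData.form_one]
  | n + 1, d, s, s', U => by
    rw [polarProd, PolarData.form_mul, form_polarProd, Fin.prod_univ_succ]

/-- A Gram datum is a polar datum with two equal feature families. -/
def PolarData.ofGram {k : GaugeConfig 4 L G → ℂ} (d : GramData k) : PolarData L G where
  κ := d.κ
  K := d.K
  feat _ := d.a
  psd := d.psd
  measK := d.measK
  bddK := d.bddK
  depK := d.depK
  measF _ := d.measA
  bddF := by obtain ⟨C, hC⟩ := d.bddA; exact ⟨C, fun _ i U => hC i U⟩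
  depF _ := d.depA

omit [Fact (1 < L)] in
/-- Its pairings are the represented function. -/
theorem PolarData.form_ofGram {k : GaugeConfig 4 L G → ℂ} (d : GramData k) (s s' : Bool) (U : GaugeConfig 4 L G) :
    (PolarData.ofGram d).form s s' U = k U :=
  (d.eq U).symm

/-- **Polarisation**: the features `a + t b` form a Gram datum representing
`form₁₁ + conj t · form₁₂ + t · form₂₁ + conj t · t · form₂₂`. -/
def PolarData.lin (d : PolarData L G) (t : ℂ) :
    GramData (fun U => d.form true true U + conj t * d.form true false U + t * d.form false true U +
      conj t * t * d.form false false U) where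
  κ := d.κ
  K := d.K
  a i U := d.feat true i U + t * d.feat false i U
  psd := d.psd
  measK := d.measK
  bddK := d.bddK
  depK := d.depK
  measA i := (d.measF true i).add ((d.measF false i).const_mul t)
  bddA := by
    obtain ⟨C, hC⟩ := d.bddF
    refine ⟨C + ‖t‖ * C, fun i U => (norm_add_le _ _).trans (add_le_add (hC true i U) ?_)⟩
    rw [norm_mul]
    exact mul_le_mul_of_nonneg_left (hC false i U) (norm_nonneg _)
  depA i U V hUV := by simp only [d.depF true i hUV, d.depF false i hUV]
  eq U := by
    simp only [PolarData.form, Finset.mul_sum, ← Finset.sum_add_distrib]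
    refine Finset.sum_congr rfl fun i _ => Finset.sum_congr rfl fun j _ => ?_
    simp only [map_add, map_mul]
    ring

variable [TopologicalSpace G] [IsTopologicalGroup G] [CompactSpace G] [BorelSpace G]

omit [Fact (1 < L)] in
/-- The pairings are integrable. -/
theorem PolarData.integrable_form (d : PolarData L G) (s s' : Bool) :
    Integrable (d.form s s') (LatticeRP.piMeasure (ι := Edge 4 L) (haarProbability G)) := by
  obtain ⟨CK, hCK⟩ := d.bddK
  obtain ⟨CF, hCF⟩ := d.bddF
  have hconj : Measurable (starRingEnd ℂ : ℂ → ℂ) := Complex.continuous_conj.measurable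
  have hΘm : Measurable (GaugeConfig.negReflect : GaugeConfig 4 L G → GaugeConfig 4 L G) :=
    WilsonSiteRP.measurable_negReflect
  refine LatticeRP.integrable_of_norm_le (Finset.measurable_sum _ fun i _ => Finset.measurable_sum _ fun j _ =>
    ((d.measK i j).mul (d.measF s i)).mul (hconj.comp ((d.measF s' j).comp hΘm)))
    (K := ∑ _i : d.κ, ∑ _j : d.κ, CK * CF * CF) fun U => ?_
  refine (norm_sum_le _ _).trans (Finset.sum_le_sum fun i _ => (norm_sum_le _ _).trans (Finset.sum_le_sum fun j _ => ?_))
  rw [norm_mul, norm_mul, Complex.norm_conj]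
  exact mul_le_mul (mul_le_mul (hCK U i j) (hCF s i U) (norm_nonneg _) ((norm_nonneg _).trans (hCK U i j)))
    (hCF s' j _) (norm_nonneg _) (mul_nonneg ((norm_nonneg _).trans (hCK U i j)) ((norm_nonneg _).trans (hCF s i U)))

/-- **The quadratic reflection-positivity inequality of a polar datum**: for every `t ∈ ℂ`,
`0 ≤ ∫ form₁₁ + conj t ∫ form₁₂ + t ∫ form₂₁ + conj t · t ∫ form₂₂`. -/
theorem PolarData.integral_lin_nonneg (hL : Even L) (d : PolarData L G) (t : ℂ) :
    0 ≤ (∫ U, d.form true true U ∂(LatticeRP.piMeasure (ι := Edge 4 L) (haarProbability G))) +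
      conj t * (∫ U, d.form true false U ∂(LatticeRP.piMeasure (ι := Edge 4 L) (haarProbability G))) +
      t * (∫ U, d.form false true U ∂(LatticeRP.piMeasure (ι := Edge 4 L) (haarProbability G))) +
      conj t * t * (∫ U, d.form false false U ∂(LatticeRP.piMeasure (ι := Edge 4 L) (haarProbability G))) := by
  have h := (d.lin t).integral_nonneg hL
  rwa [integral_add, integral_add, integral_add, integral_const_mul, integral_const_mul, integral_const_mul] at h
  · exact d.integrable_form true true
  · exact (d.integrable_form true false).const_mul _
  · exact (d.integrable_form true true).add ((d.integrable_form true false).const_mul _)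
  · exact (d.integrable_form false true).const_mul _
  · exact ((d.integrable_form true true).add ((d.integrable_form true false).const_mul _)).add
      ((d.integrable_form false true).const_mul _)
  · exact (d.integrable_form false false).const_mul _

end Polar

/-- **Cauchy–Schwarz from the quadratic inequality**: if
`0 ≤ Z₁₁ + conj t · Z₁₂ + t · Z₂₁ + conj t · t · Z₂₂` (as complex numbers) for every `t ∈ ℂ` and
`0 ≤ Z₂₂`, then `Z₁₁ ≥ 0` and `‖Z₁₂‖² ≤ Re Z₁₁ · Re Z₂₂`. -/
theorem cs_of_forall_quadratic {Z₁₁ Z₁₂ Z₂₁ Z₂₂ : ℂ}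
    (h : ∀ t : ℂ, 0 ≤ Z₁₁ + conj t * Z₁₂ + t * Z₂₁ + conj t * t * Z₂₂) (h₂₂ : 0 ≤ Z₂₂) :
    0 ≤ Z₁₁.re ∧ ‖Z₁₂‖ ^ 2 ≤ Z₁₁.re * Z₂₂.re := by
  have h0 := h 0
  simp only [map_zero, zero_mul, add_zero] at h0
  have him : ∀ t : ℂ, (Z₁₁ + conj t * Z₁₂ + t * Z₂₁ + conj t * t * Z₂₂).im = 0 := fun t =>
    (Complex.nonneg_iff.1 (h t)).2.symm
  have i0 : Z₁₁.im = 0 := (Complex.nonneg_iff.1 h0).2.symm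
  have i22 : Z₂₂.im = 0 := (Complex.nonneg_iff.1 h₂₂).2.symm
  have i1 := him 1
  have im1 := him (-1)
  have iI := him I
  simp only [map_one, map_neg, Complex.conj_I, Complex.add_im, Complex.mul_im, Complex.one_re, Complex.one_im,
    Complex.neg_re, Complex.neg_im, Complex.I_re, Complex.I_im, Complex.mul_re, i0, i22] at i1 im1 iI
  have hre : Z₂₁.re = Z₁₂.re := by linarith [iI]
  have hconj : Z₂₁ = conj Z₁₂ := by
    apply Complex.ext
    · simpa using hre
    · simp only [Complex.conj_im]; linarith
  refine ⟨(Complex.nonneg_iff.1 h0).1, ?_⟩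
  have key := WilsonSiteRP.normSq_le_mul_of_forall_quadratic (a := Z₁₁.re) (c := Z₂₂.re) (b := Z₂₁)
    (Complex.nonneg_iff.1 h0).1 (Complex.nonneg_iff.1 h₂₂).1 fun t => by
      have ht := (Complex.nonneg_iff.1 (h t)).1
      have e1 : (conj t * Z₁₂).re = (t * Z₂₁).re := by
        rw [hconj, show t * conj Z₁₂ = conj (conj t * Z₁₂) by rw [map_mul, Complex.conj_conj], Complex.conj_re]
      have e2 : (conj t * t * Z₂₂).re = ‖t‖ ^ 2 * Z₂₂.re := by
        rw [mul_comm (conj t) t, Complex.mul_conj, Complex.re_ofReal_mul, Complex.normSq_eq_norm_sq]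
      simp only [Complex.add_re] at ht
      linarith
  rwa [hconj, Complex.norm_conj] at key

end Summit.QuantumFields.QCD.Theorems.UnquenchedChessboardBoundLine

end
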